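import Mathlib
import Summits.Ventures.PercRepro2.Defs
import Summits.Ventures.PercRepro2.Graph
import Summits.Ventures.PercRepro2.OneColourSwitch
import Summits.Ventures.PercRepro2.RegionHubSign
import Summits.Ventures.PercRepro2.SideSwitch
import Summits.Ventures.PercRepro2.SideSwitchFibre
import Summits.Ventures.PercRepro2.SideSwitchMono
import Summits.Ventures.PercRepro2.SideSwitchClosed
import Summits.Ventures.PercRepro2.SideSwitchComps
import Summits.Ventures.PercRepro2.SideSwitchCompsFibre
import Summits.Ventures.PercRepro2.M9NoPocketDefs
import Summits.Ventures.PercRepro2.M9NoPocketWorld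
import Summits.Ventures.PercRepro2.M9NoPocketWorldD
import Summits.Ventures.PercRepro2.M9NoPocketLegal

/-!
# The single-`d` class without a pocket — the outside flip and the complement identity (blind
cell PercRepro2, p3 g20, 2026-08-27; `proofs/P3-CPNC.md` §17c (vi))

`flipOp ρ` flips the edges inside the unexplored part of `G − d` (`d` included, so that the
loops at `d` are flipped as well); it preserves the representatives, the blocks, the dead and
source edges of `d` and the legal vectors (`flipOp_mem_RepD`, `blocks_flipOp`, `L4_flipOp`),
it is an involution (`flipOp_flipOp`), and it commutes with the assignment (`assignX_flipOp`).
The dual vector `cdual ρ x` is defined here.  `σ_rs` is blind to the outside flip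
(`M9NoPocketFlipRS`); the complement identity is `M9NoPocketCompl2`.  Own work; std axioms.
-/

namespace Summit.Ventures.PercRepro2

namespace NoPocket

open Finset Classical RegionHub OneColourSwitch SideSwitch

variable {V : Type*} {E : Type*}

section Compl

variable [Fintype V] [DecidableEq V] [Fintype E] [DecidableEq E]

variable (ends : E → Sym2 V)

/-- The unexplored part of `G − d` (with `d`): the complement of the two worlds of `{r, s}` in
`G − d`. -/
def Oprime (d r s : V) (ρ : Config E) : Set V := Oset (endsD ends d) r s ρ

/-- The outside flip: flip every edge inside the unexplored part of `G − d`. -/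
noncomputable def flipOp (d r s : V) (ρ : Config E) : Config E :=
  flipIn ends (Oprime ends d r s ρ) ρ

/-- The dual vector: the complementary blocks and the complementary `T`-edges. -/
noncomputable def cdual (d r s : V) (ρ : Config E) (x : Finset (Finset V) × Finset E) :
    Finset (Finset V) × Finset E :=
  (blocks ends d r s ρ \ x.1, Tset ends d r s \ x.2)

variable {ends}

omit [Fintype V] [DecidableEq V] [Fintype E] [DecidableEq E] in
/-- Membership in `Oprime`. -/
lemma mem_Oprime {d r s : V} {ρ : Config E} {y : V} :
    y ∈ Oprime ends d r s ρ ↔ y ∉ K2 (endsD ends d) r s ρ ∧ y ∉ M2 (endsD ends d) r s ρ := by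
  simp only [Oprime, Oset, Set.mem_compl_iff, Set.mem_union, not_or]

omit [Fintype V] [DecidableEq V] [Fintype E] [DecidableEq E] in
/-- `d` lies in `Oprime`. -/
lemma d_mem_Oprime {d r s : V} (hr : d ≠ r) (hs : d ≠ s) (ρ : Config E) :
    d ∈ Oprime ends d r s ρ :=
  mem_Oprime.2 ⟨not_mem_K2_endsD hr hs ρ, not_mem_M2_endsD hr hs ρ⟩

omit [Fintype V] [DecidableEq V] [Fintype E] [DecidableEq E] in
/-- An edge with an endpoint in a world of `G − d` is not inside `Oprime`. -/
lemma not_mem_within_Oprime_of_mem_world {d r s : V} {ρ : Config E} {e : E} {y z : V}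
    (hyz : ends e = s(y, z)) (hy : y ∈ K2 (endsD ends d) r s ρ ∨ y ∈ M2 (endsD ends d) r s ρ) :
    e ∉ within ends (Oprime ends d r s ρ) := by
  rintro ⟨a, ha, b, hb, hab⟩
  rw [hyz, Sym2.eq_iff] at hab
  rcases hab with ⟨h1, _⟩ | ⟨h1, _⟩
  · rw [← h1] at ha
    exact hy.elim (mem_Oprime.1 ha).1 (mem_Oprime.1 ha).2
  · rw [← h1] at hb
    exact hy.elim (mem_Oprime.1 hb).1 (mem_Oprime.1 hb).2

omit [Fintype V] [DecidableEq V] [Fintype E] [DecidableEq E] in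
/-- The outside flip on an edge not inside `Oprime`. -/
lemma flipOp_of_notMem {d r s : V} {ρ : Config E} {e : E}
    (he : e ∉ within ends (Oprime ends d r s ρ)) : flipOp ends d r s ρ e = ρ e :=
  flipIn_of_notMem he

omit [Fintype V] [DecidableEq V] [Fintype E] [DecidableEq E] in
/-- The outside flip on an edge inside `Oprime`. -/
lemma flipOp_of_mem {d r s : V} {ρ : Config E} {e : E}
    (he : e ∈ within ends (Oprime ends d r s ρ)) : flipOp ends d r s ρ e = !ρ e :=
  flipIn_of_mem he

omit [Fintype V] [DecidableEq V] [Fintype E] [DecidableEq E] in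
/-- The `Y`-world of `G − d` ignores the outside flip. -/
lemma K2_endsD_flipOp {d r s : V} (hr : d ≠ r) (hs : d ≠ s) (ρ : Config E) :
    K2 (endsD ends d) r s (flipOp ends d r s ρ) = K2 (endsD ends d) r s ρ := by
  apply expl_eq_of_eqOn_touches
  intro e he
  obtain ⟨y, hy, z, hyz⟩ := he
  by_cases hd : d ∈ ends e
  · rw [endsD_of_mem hd, Sym2.eq_iff] at hyz
    exfalso
    rcases hyz with ⟨h1, _⟩ | ⟨_, h1⟩ <;> rw [← h1] at hy <;> exact not_mem_K2_endsD hr hs ρ hy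
  · rw [endsD_of_notMem hd] at hyz
    exact (flipOp_of_notMem (not_mem_within_Oprime_of_mem_world hyz (Or.inl hy))).symm

omit [Fintype V] [DecidableEq V] [Fintype E] [DecidableEq E] in
/-- The colour flip commutes with the outside flip. -/
lemma compl_flipOp {d r s : V} (ρ : Config E) :
    OneColourSwitch.compl (flipOp ends d r s ρ) = flipIn ends (Oprime ends d r s ρ) (OneColourSwitch.compl ρ) :=
  compl_flipIn _ _

omit [Fintype V] [DecidableEq V] [Fintype E] [DecidableEq E] in
/-- `Oprime` is invariant under the colour flip. -/
lemma Oprime_compl {d r s : V} (ρ : Config E) :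
    Oprime ends d r s (OneColourSwitch.compl ρ) = Oprime ends d r s ρ :=
  Oset_compl (ends := endsD ends d) r s ρ

omit [Fintype V] [DecidableEq V] [Fintype E] [DecidableEq E] in
/-- The `W`-world of `G − d` ignores the outside flip. -/
lemma M2_endsD_flipOp {d r s : V} (hr : d ≠ r) (hs : d ≠ s) (ρ : Config E) :
    M2 (endsD ends d) r s (flipOp ends d r s ρ) = M2 (endsD ends d) r s ρ := by
  rw [← K2_compl, compl_flipOp, ← Oprime_compl ρ]
  exact K2_endsD_flipOp hr hs (OneColourSwitch.compl ρ)

omit [Fintype V] [DecidableEq V] [Fintype E] [DecidableEq E] in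
/-- `Oprime` is preserved by the outside flip. -/
lemma Oprime_flipOp {d r s : V} (hr : d ≠ r) (hs : d ≠ s) (ρ : Config E) :
    Oprime ends d r s (flipOp ends d r s ρ) = Oprime ends d r s ρ := by
  show (K2 (endsD ends d) r s (flipOp ends d r s ρ) ∪ M2 (endsD ends d) r s (flipOp ends d r s ρ))ᶜ =
    Oprime ends d r s ρ
  rw [K2_endsD_flipOp hr hs, M2_endsD_flipOp hr hs]
  rfl

omit [Fintype V] [DecidableEq V] [Fintype E] [DecidableEq E] in
/-- The outside flip is an involution. -/
lemma flipOp_flipOp {d r s : V} (hr : d ≠ r) (hs : d ≠ s) (ρ : Config E) :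
    flipOp ends d r s (flipOp ends d r s ρ) = ρ := by
  have h := Oprime_flipOp (ends := ends) hr hs ρ
  unfold flipOp at h ⊢
  rw [h, flipIn_flipIn]

omit [Fintype V] [DecidableEq E] in
/-- A `T`-edge is not inside `Oprime`. -/
lemma Tset_not_mem_within_Oprime {d r s : V} (ρ : Config E) {e : E} (he : e ∈ Tset ends d r s) :
    e ∉ within ends (Oprime ends d r s ρ) := by
  rcases mem_Tset.1 he with h | h
  · exact not_mem_within_Oprime_of_mem_world (by rw [h, Sym2.eq_swap]) (Or.inl (r_mem_K2 r s ρ))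
  · exact not_mem_within_Oprime_of_mem_world (by rw [h, Sym2.eq_swap]) (Or.inl (s_mem_K2 r s ρ))

omit [Fintype E] [DecidableEq E] in
/-- An edge at a block vertex is not inside `Oprime`. -/
lemma block_edge_not_mem_within_Oprime {d r s : V} {ρ : Config E} {C : Finset V}
    (hC : C ∈ blocks ends d r s ρ) {y : V} (hy : y ∈ C) {e : E} {z : V} (he : ends e = s(y, z)) :
    e ∉ within ends (Oprime ends d r s ρ) := by
  have hyA : y ∈ A0 (endsD ends d) r s ρ := subset_A0_of_mem_comps (ends := endsD ends d) hC hy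
  exact not_mem_within_Oprime_of_mem_world he (mem_A0.1 hyA).1

/-- The outside flip preserves the representatives. -/
lemma flipOp_mem_RepD {p q r s d : V} (hr : d ≠ r) (hs : d ≠ s) {ρ : Config E}
    (hρ : ρ ∈ RepD ends p q r s d) : flipOp ends d r s ρ ∈ RepD ends p q r s d := by
  obtain ⟨hsep, hM, hY⟩ := mem_RepD.1 hρ
  rw [mem_RepD]
  refine ⟨?_, ?_, ?_⟩
  · rw [sep2_iff, K2_endsD_flipOp hr hs, M2_endsD_flipOp hr hs]
    exact sep2_iff.1 hsep
  · intro y hy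
    rw [M2_endsD_flipOp hr hs] at hy
    exact hM y hy
  · intro e he
    rw [flipOp_of_notMem (Tset_not_mem_within_Oprime ρ he)]
    exact hY e he

omit [Fintype E] [DecidableEq E] in
/-- The blocks are preserved by the outside flip. -/
lemma blocks_flipOp {d r s : V} (hr : d ≠ r) (hs : d ≠ s) (ρ : Config E) :
    blocks ends d r s (flipOp ends d r s ρ) = blocks ends d r s ρ := by
  have hA : A0 (endsD ends d) r s (flipOp ends d r s ρ) = A0 (endsD ends d) r s ρ := by
    ext y
    simp only [mem_A0]
    rw [K2_endsD_flipOp hr hs, M2_endsD_flipOp hr hs]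
  simp only [blocks, comps, hA]

omit [Fintype E] [DecidableEq E] in
/-- The `Y` edges of `d` to a block are preserved by the outside flip. -/
lemma hasY_flipOp {d r s : V} {ρ : Config E} {C : Finset V} (hC : C ∈ blocks ends d r s ρ) :
    hasY ends d (flipOp ends d r s ρ) C ↔ hasY ends d ρ C := by
  constructor <;> rintro ⟨e, y, hy, hends, hρe⟩ <;> refine ⟨e, y, hy, hends, ?_⟩
  · rwa [flipOp_of_notMem (block_edge_not_mem_within_Oprime hC hy (by rw [hends, Sym2.eq_swap]))]
      at hρe
  · rwa [flipOp_of_notMem (block_edge_not_mem_within_Oprime hC hy (by rw [hends, Sym2.eq_swap]))]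

omit [Fintype E] [DecidableEq E] in
/-- The `W` edges of `d` to a block are preserved by the outside flip. -/
lemma hasW_flipOp {d r s : V} {ρ : Config E} {C : Finset V} (hC : C ∈ blocks ends d r s ρ) :
    hasW ends d (flipOp ends d r s ρ) C ↔ hasW ends d ρ C := by
  constructor <;> rintro ⟨e, y, hy, hends, hρe⟩ <;> refine ⟨e, y, hy, hends, ?_⟩
  · rwa [flipOp_of_notMem (block_edge_not_mem_within_Oprime hC hy (by rw [hends, Sym2.eq_swap]))]
      at hρe
  · rwa [flipOp_of_notMem (block_edge_not_mem_within_Oprime hC hy (by rw [hends, Sym2.eq_swap]))]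

omit [DecidableEq E] in
/-- The `Y`-sources are preserved by the outside flip. -/
lemma srcY_flipOp {d r s : V} (hr : d ≠ r) (hs : d ≠ s) (ρ : Config E)
    (x : Finset (Finset V) × Finset E) :
    srcY ends d r s (flipOp ends d r s ρ) x ↔ srcY ends d r s ρ x := by
  simp only [srcY, blocks_flipOp hr hs]
  constructor <;> rintro (h | ⟨C, hC, hCx, hY⟩)
  · exact Or.inl h
  · exact Or.inr ⟨C, hC, hCx, (hasY_flipOp hC).1 hY⟩
  · exact Or.inl h
  · exact Or.inr ⟨C, hC, hCx, (hasY_flipOp hC).2 hY⟩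

omit [DecidableEq E] in
/-- The `W`-sources are preserved by the outside flip. -/
lemma srcW_flipOp {d r s : V} {ρ : Config E} {x : Finset (Finset V) × Finset E}
    (hT : x.1 ⊆ blocks ends d r s ρ) :
    srcW ends d r s (flipOp ends d r s ρ) x ↔ srcW ends d r s ρ x := by
  simp only [srcW]
  constructor <;> rintro (h | ⟨C, hCx, hY⟩)
  · exact Or.inl h
  · exact Or.inr ⟨C, hCx, (hasY_flipOp (hT hCx)).1 hY⟩
  · exact Or.inl h
  · exact Or.inr ⟨C, hCx, (hasY_flipOp (hT hCx)).2 hY⟩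

omit [DecidableEq E] in
/-- The legal vectors are preserved by the outside flip. -/
lemma L4_flipOp {d r s : V} (hr : d ≠ r) (hs : d ≠ s) (ρ : Config E) :
    L4 ends d r s (flipOp ends d r s ρ) = L4 ends d r s ρ := by
  ext x
  simp only [mem_L4, blocks_flipOp hr hs]
  constructor
  · rintro ⟨⟨hT, hF⟩, hW, hY⟩
    refine ⟨⟨hT, hF⟩, ?_, ?_⟩
    · intro hsrc C hC hCx hW'
      exact hW ((srcW_flipOp hT).2 hsrc) C hC hCx ((hasW_flipOp hC).2 hW')
    · intro hsrc C hCx hW'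
      exact hY ((srcY_flipOp hr hs ρ x).2 hsrc) C hCx ((hasW_flipOp (hT hCx)).2 hW')
  · rintro ⟨⟨hT, hF⟩, hW, hY⟩
    refine ⟨⟨hT, hF⟩, ?_, ?_⟩
    · intro hsrc C hC hCx hW'
      exact hW ((srcW_flipOp hT).1 hsrc) C hC hCx ((hasW_flipOp hC).1 hW')
    · intro hsrc C hCx hW'
      exact hY ((srcY_flipOp hr hs ρ x).1 hsrc) C hCx ((hasW_flipOp (hT hCx)).1 hW')

omit [Fintype V] [DecidableEq V] [Fintype E] in
/-- `flipIn` commutes with `flipF`. -/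
lemma flipIn_flipF (S : Set V) (F : Finset E) (ω : Config E) :
    flipIn ends S (flipF F ω) = flipF F (flipIn ends S ω) := by
  funext e
  by_cases h1 : e ∈ within ends S <;> by_cases h2 : e ∈ F <;>
    simp [flipIn, flipF, h1, h2]

omit [Fintype V] [Fintype E] in
/-- The assignment of the outside-flipped representative is the outside flip of the
assignment. -/
lemma assignX_flipOp {d r s : V} (ρ : Config E) (x : Finset (Finset V) × Finset E) :
    assignX ends x (flipOp ends d r s ρ) = flipIn ends (Oprime ends d r s ρ) (assignX ends x ρ) := by
  simp only [assignX, flipOp]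
  rw [flipIn_flipTouch, flipIn_flipF]

end Compl

end NoPocket

end Summit.Ventures.PercRepro2
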